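import Summits.CriticalPhenomena.PercolationContinuityZ3.Theorems.FK.ClusterCountErgodic
import Summits.CriticalPhenomena.PercolationContinuityZ3.Theorems.FK.BoxClusterCountWired
import HarnessLib

/-!
# FK-continuity cell, FO-10a: Grimmett 2006 (4.83) WITH GRIMMETT'S OWN CLUSTER COUNT `k(ω,Λ)` = the number of open
# clusters of `ω` (on all of `ℤ^d`) that INTERSECT `Λ` ((4.12)): `k(ω,Λ_N)/|Λ_N| → κ^b(p,q)` `φ^b_{p,q}`-a.s. and in `L¹`

Registered R118 (cell INBOX l.7669, 2026-08-25); registry row FO-10a-g343; label STR-E (coordinator fk-4 g231).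
Cell `fk-continuity` (bschramm), row FO-10a (pressure layer); support file for the FK-continuity transplant
(`--supports stmt-CriticalPhenomena-4575`); builds on p205010 (kernel theorem, internal audit signed; external expert
review pending). Pure proofs; no definitions, no named facts, no sorries; every `d ≥ 1`, `0 ≤ p ≤ 1`, `q ≥ 1`, both
boundary conditions `b`. UNCONDITIONAL infinite-volume structure; it decides nothing about FH / TP_FK / the value of
`κ^b(p,q)`.

Grimmett 2006 defines (p. 71, after (4.11)) `k(ω,Λ)` as "the number of components of the graph `(ℤ^d, η(ω))` that
intersect `Λ`", and p. 94 uses `k(ω,Λ) = Σ_{x∈Λ} |C_x ∩ Λ|⁻¹` with `C_x` the `ω`-open cluster of `x` IN `ℤ^d`.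
`ClusterCountErgodic.lean` proved (4.83) for the count `Σ_{x∈Λ} |C_x(ω ∩ E_Λ)|⁻¹` of the clusters of the RESTRICTED
configuration `ω ∩ E_Λ` (the free finite-volume count). The two counts sandwich: termwise
`|C_x(ω)|⁻¹ ≤ |C_x(ω) ∩ Λ|⁻¹ ≤ |C_x(ω ∩ E_Λ)|⁻¹` (`C_x(ω ∩ E_Λ) ⊆ C_x(ω) ∩ Λ ⊆ C_x(ω)`), and both outer averages tend to
`κ^b(p,q) = φ^b_{p,q}(|C_0|⁻¹)` almost surely (`BoxErgodicAveragesFK`, `ClusterCountErgodic`). Hence (4.83) for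
Grimmett's own `k`:

* `sum_inv_card_filter_mem_openCluster_eq_card_image` — `Σ_{x∈Λ} |C_x(ω) ∩ Λ|⁻¹ = #{C_x(ω) : x ∈ Λ}`, the number of
  open clusters of `ω` meeting `Λ` (Grimmett's `k(ω,Λ)`);
* `inv_ncard_le_inv_card_filter_mem_openCluster`, `inv_card_filter_mem_openCluster_le_inv_ncard_inter` — the sandwich;
* **`ae_tendsto_card_image_openCluster_div_card_box`** — `|Λ_N|⁻¹ · #{open clusters of ω meeting Λ_N} → κ^b(p,q)` for
  `φ^b_{p,q}`-a.e. `ω`; **`tendsto_integral_abs_card_image_openCluster_div_card_box_sub`** — and in `L¹(φ^b_{p,q})`.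

## References

* G. Grimmett, *The Random-Cluster Model*, Springer 2006 (`book:grimmett2006-random-cluster-model`): (4.11)–(4.12)
  [PDF p. 71], §4.5 (4.83) and the displays before it [PDF p. 94], Cor. (4.23). [Grimmett2006]
-/

noncomputable section

open MeasureTheory Set Filter Finset
open scoped Topology ENNReal

namespace Summit.CriticalPhenomena.PercolationContinuityZ3.Theorems.FK

open Literature.Probability.Percolation Literature.Probability.LatticeModels

variable {d : ℕ} {p q : ℝ}

/-! ### Grimmett's `k(ω,Λ)`: clusters of `ω` meeting `Λ` -/

open Classical in
/-- **`Σ_{x∈Λ} |C_x(ω) ∩ Λ|⁻¹ = #{C_x(ω) : x ∈ Λ}`** — the number of open clusters of `ω` that intersect `Λ` (each such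
cluster `C` contributes `Σ_{x ∈ C ∩ Λ} |C ∩ Λ|⁻¹ = 1`). [cite: Grimmett2006, (4.12) and p. 94 (k(ω,Λ) = Σ_x |C_x ∩ Λ|⁻¹)] -/
theorem sum_inv_card_filter_mem_openCluster_eq_card_image (ω : BondConfig (Site d)) (Λ : Finset (Site d)) :
    ∑ x ∈ Λ, ((#(Λ.filter fun y => y ∈ openCluster ω x) : ℝ))⁻¹ = #(Λ.image fun x => openCluster ω x) := by
  rw [← Finset.sum_fiberwise_of_maps_to (s := Λ) (t := Λ.image fun x => openCluster ω x)
    (g := fun x => openCluster ω x) (fun x hx => mem_image_of_mem _ hx), Finset.card_eq_sum_ones (Λ.image _),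
    Nat.cast_sum]
  refine Finset.sum_congr rfl fun C hC => ?_
  -- on the fibre of `C` the summand is the constant `(#fibre)⁻¹`
  have hfib : ∀ x ∈ Λ.filter (fun x => openCluster ω x = C),
      (Λ.filter fun y => y ∈ openCluster ω x) = Λ.filter fun y => openCluster ω y = C := by
    intro x hx
    obtain ⟨-, hxC⟩ := mem_filter.1 hx
    refine Finset.filter_congr fun y _ => ?_
    rw [← hxC]
    constructor
    · intro hy
      have hr : (openGraph ω).Reachable x y := hy
      exact Set.ext fun z => ⟨fun hz => hr.trans hz, fun hz => hr.symm.trans hz⟩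
    · intro hyx
      rw [← hyx]
      exact mem_openCluster_self ω y
  rw [Finset.sum_congr rfl fun x hx => by rw [hfib x hx], Finset.sum_const, nsmul_eq_mul, Nat.cast_one]
  have hne : (Λ.filter fun y => openCluster ω y = C).Nonempty := by
    obtain ⟨x, hx, rfl⟩ := mem_image.1 hC
    exact ⟨x, mem_filter.2 ⟨hx, rfl⟩⟩
  exact mul_inv_cancel₀ (by exact_mod_cast hne.card_pos.ne')

/-! ### The sandwich `|C_x|⁻¹ ≤ |C_x ∩ Λ|⁻¹ ≤ |C_x(ω ∩ E_Λ)|⁻¹` -/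

open Classical in
/-- `|C_x(ω)|⁻¹ ≤ |C_x(ω) ∩ Λ|⁻¹` for `x ∈ Λ` (with `|C|⁻¹ = 0` for infinite `C`). [cite: Grimmett2006, p. 94 (display before (4.83))] -/
theorem inv_ncard_le_inv_card_filter_mem_openCluster (ω : BondConfig (Site d)) {Λ : Finset (Site d)} {x : Site d}
    (hx : x ∈ Λ) :
    (((openCluster ω x).ncard : ℝ))⁻¹ ≤ ((#(Λ.filter fun y => y ∈ openCluster ω x) : ℝ))⁻¹ := by
  have hpos : (0 : ℝ) < #(Λ.filter fun y => y ∈ openCluster ω x) := by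
    exact_mod_cast Finset.card_pos.2 ⟨x, mem_filter.2 ⟨hx, mem_openCluster_self ω x⟩⟩
  by_cases hfin : (openCluster ω x).Finite
  · refine inv_anti₀ hpos ?_
    have h : #(Λ.filter fun y => y ∈ openCluster ω x) ≤ (openCluster ω x).ncard := by
      rw [← Set.ncard_coe_finset]
      exact Set.ncard_le_ncard (fun y hy => (mem_filter.1 (Finset.mem_coe.1 hy)).2) hfin
    exact_mod_cast h
  · rw [Set.Infinite.ncard hfin, Nat.cast_zero, inv_zero]
    exact inv_nonneg.2 hpos.le

open Classical in
/-- `|C_x(ω) ∩ Λ|⁻¹ ≤ |C_x(ω ∩ E_Λ)|⁻¹` for `x ∈ Λ`: the cluster of `x` in the restricted configuration lies in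
`C_x(ω) ∩ Λ`. [cite: Grimmett2006, p. 94 (display before (4.83))] -/
theorem inv_card_filter_mem_openCluster_le_inv_ncard_inter (ω : BondConfig (Site d)) {Λ : Finset (Site d)}
    {x : Site d} (hx : x ∈ Λ) :
    ((#(Λ.filter fun y => y ∈ openCluster ω x) : ℝ))⁻¹ ≤
      (((openCluster (ω ∩ ↑(edgesIn (zdGraph d) Λ)) x).ncard : ℝ))⁻¹ := by
  have hsub : openCluster (ω ∩ ↑(edgesIn (zdGraph d) Λ)) x ⊆ ↑(Λ.filter fun y => y ∈ openCluster ω x) := by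
    intro y hy
    rw [Finset.coe_filter]
    exact ⟨openCluster_inter_edgesIn_subset ω hx hy, openCluster_mono Set.inter_subset_left x hy⟩
  have hfin : (openCluster (ω ∩ ↑(edgesIn (zdGraph d) Λ)) x).Finite := (Finset.finite_toSet _).subset hsub
  have hpos : (0 : ℝ) < (openCluster (ω ∩ ↑(edgesIn (zdGraph d) Λ)) x).ncard := by
    exact_mod_cast (Set.ncard_pos hfin).2 ⟨x, mem_openCluster_self _ x⟩
  refine inv_anti₀ hpos ?_
  have h : (openCluster (ω ∩ ↑(edgesIn (zdGraph d) Λ)) x).ncard ≤ #(Λ.filter fun y => y ∈ openCluster ω x) := by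
    rw [← Set.ncard_coe_finset]
    exact Set.ncard_le_ncard hsub (Finset.finite_toSet _)
  exact_mod_cast h

open Classical in
/-- The sandwich summed over the box: `Σ_{x∈Λ} |C_x|⁻¹ ≤ Σ_{x∈Λ} |C_x ∩ Λ|⁻¹ ≤ Σ_{x∈Λ} |C_x(ω ∩ E_Λ)|⁻¹`.
[cite: Grimmett2006, p. 94 (display before (4.83))] -/
theorem sum_inv_ncard_le_sum_inv_card_filter_le (ω : BondConfig (Site d)) (Λ : Finset (Site d)) :
    ∑ x ∈ Λ, (((openCluster ω x).ncard : ℝ))⁻¹ ≤ ∑ x ∈ Λ, ((#(Λ.filter fun y => y ∈ openCluster ω x) : ℝ))⁻¹ ∧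
      ∑ x ∈ Λ, ((#(Λ.filter fun y => y ∈ openCluster ω x) : ℝ))⁻¹ ≤
        ∑ x ∈ Λ, (((openCluster (ω ∩ ↑(edgesIn (zdGraph d) Λ)) x).ncard : ℝ))⁻¹ :=
  ⟨Finset.sum_le_sum fun _ hx => inv_ncard_le_inv_card_filter_mem_openCluster ω hx,
    Finset.sum_le_sum fun _ hx => inv_card_filter_mem_openCluster_le_inv_ncard_inter ω hx⟩

/-! ### (4.83) for Grimmett's `k(ω,Λ)` -/

open Classical in
/-- **Grimmett 2006, (4.83), almost surely, with `k(ω,Λ)` = the number of open clusters of `ω` intersecting `Λ`**: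
for `d ≥ 1`, `0 ≤ p ≤ 1`, `q ≥ 1`, `b ∈ {0,1}` and `φ^b_{p,q}`-a.e. `ω`,
`|Λ_N|⁻¹ · #{open clusters of ω meeting Λ_N} → κ^b(p,q) = ∫ |C_0|⁻¹ dφ^b_{p,q}`.
[cite: Grimmett2006, §4.5 (4.83) with (4.12) and Cor. (4.23)] -/
theorem ae_tendsto_card_image_openCluster_div_card_box (hd : 1 ≤ d) (b : Bool) (hp : p ∈ Set.Icc (0 : ℝ) 1)
    (hq : 1 ≤ q) :
    ∀ᵐ ω ∂(rcLimit d b p q), Tendsto (fun N : ℕ => ((#(box d N) : ℝ))⁻¹ *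
      (#((box d N).image fun x => openCluster ω x) : ℝ)) atTop
        (𝓝 (∫ ω', ((openCluster ω' (0 : Site d)).ncard : ℝ)⁻¹ ∂(rcLimit d b p q))) := by
  filter_upwards [ae_tendsto_boxAverage_inv_ncard_rcLimit hd b hp hq, ae_tendsto_clusterCount_div_card_box hd b hp hq]
    with ω hlow hup
  refine tendsto_of_tendsto_of_tendsto_of_le_of_le hlow hup (fun N => ?_) (fun N => ?_)
  · rw [← sum_inv_card_filter_mem_openCluster_eq_card_image]
    exact mul_le_mul_of_nonneg_left (sum_inv_ncard_le_sum_inv_card_filter_le ω (box d N)).1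
      (inv_nonneg.2 (Nat.cast_nonneg _))
  · rw [← sum_inv_card_filter_mem_openCluster_eq_card_image]
    exact mul_le_mul_of_nonneg_left (sum_inv_ncard_le_sum_inv_card_filter_le ω (box d N)).2
      (inv_nonneg.2 (Nat.cast_nonneg _))

open Classical in
/-- `ω ↦ #{open clusters of ω meeting Λ}` is measurable (it is `Σ_{x∈Λ} |C_x ∩ Λ|⁻¹`, a finite combination of the
connection events `{x ↔ y}`). [folklore] -/
theorem measurable_card_image_openCluster (Λ : Finset (Site d)) :
    Measurable fun ω : BondConfig (Site d) => ((#(Λ.image fun x => openCluster ω x) : ℝ)) := by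
  have h : (fun ω : BondConfig (Site d) => ((#(Λ.image fun x => openCluster ω x) : ℝ))) =
      fun ω => ∑ x ∈ Λ, ((∑ y ∈ Λ, (openConn x y : Set (BondConfig (Site d))).indicator (1 : BondConfig (Site d) → ℝ) ω))⁻¹ := by
    funext ω
    rw [← sum_inv_card_filter_mem_openCluster_eq_card_image]
    refine Finset.sum_congr rfl fun x _ => ?_
    congr 1
    rw [Finset.card_filter, Nat.cast_sum]
    refine Finset.sum_congr rfl fun y _ => ?_
    rw [Set.indicator_apply]
    simp only [Pi.one_apply, Nat.cast_ite, Nat.cast_one, Nat.cast_zero]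
    rfl
  rw [h]
  refine Finset.measurable_sum _ fun x _ => (Finset.measurable_sum _ fun y _ => ?_).inv
  exact (measurable_const.indicator (measurableSet_openConn_holds x y))

open Classical in
/-- **Grimmett 2006, (4.83), in `L¹`, with `k(ω,Λ)` = the number of open clusters of `ω` intersecting `Λ`**:
`∫ | |Λ_N|⁻¹ #{open clusters of ω meeting Λ_N} − κ^b(p,q) | dφ^b_{p,q} → 0` (`d ≥ 1`, `0 ≤ p ≤ 1`, `q ≥ 1`, `b ∈ {0,1}`;
dominated convergence from the almost-sure statement, the ratio lying in `[0,1]`).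
[cite: Grimmett2006, §4.5 (4.83) with (4.12) and Cor. (4.23)] -/
theorem tendsto_integral_abs_card_image_openCluster_div_card_box_sub (hd : 1 ≤ d) (b : Bool)
    (hp : p ∈ Set.Icc (0 : ℝ) 1) (hq : 1 ≤ q) :
    Tendsto (fun N : ℕ => ∫ ω, |((#(box d N) : ℝ))⁻¹ * (#((box d N).image fun x => openCluster ω x) : ℝ) -
        ∫ ω', ((openCluster ω' (0 : Site d)).ncard : ℝ)⁻¹ ∂(rcLimit d b p q)| ∂(rcLimit d b p q)) atTop (𝓝 0) := by
  haveI := isProbabilityMeasure_rcLimit (d := d) b p q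
  set P := rcLimit d b p q with hP
  set κ := ∫ ω', ((openCluster ω' (0 : Site d)).ncard : ℝ)⁻¹ ∂P with hκ
  have hκ0 : 0 ≤ κ := integral_nonneg fun ω => inv_nonneg.2 (Nat.cast_nonneg _)
  have hκ1 : κ ≤ 1 := by
    calc κ ≤ ∫ _, (1 : ℝ) ∂P := integral_mono (integrable_inv_ncard_openCluster' (0 : Site d) P) (integrable_const _)
          fun ω => Nat.cast_inv_le_one _
      _ = 1 := by rw [integral_const, smul_eq_mul, probReal_univ, one_mul]
  -- the ratio lies in `[0,1]`: at most `|Λ|` clusters meet `Λ`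
  have hratio : ∀ (N : ℕ) (ω : BondConfig (Site d)),
      0 ≤ ((#(box d N) : ℝ))⁻¹ * (#((box d N).image fun x => openCluster ω x) : ℝ) ∧
      ((#(box d N) : ℝ))⁻¹ * (#((box d N).image fun x => openCluster ω x) : ℝ) ≤ 1 := by
    intro N ω
    have hpos : (0 : ℝ) < #(box d N) := by exact_mod_cast (box_nonempty d N).card_pos
    refine ⟨mul_nonneg (inv_nonneg.2 hpos.le) (Nat.cast_nonneg _), ?_⟩
    rw [inv_mul_le_iff₀ hpos, mul_one]
    exact_mod_cast Finset.card_image_le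
  have hmeas : ∀ N : ℕ, AEStronglyMeasurable (fun ω : BondConfig (Site d) =>
      |((#(box d N) : ℝ))⁻¹ * (#((box d N).image fun x => openCluster ω x) : ℝ) - κ|) P := fun N =>
    ((((measurable_card_image_openCluster (box d N)).const_mul _).sub measurable_const).abs).aestronglyMeasurable
  have hlim := tendsto_integral_of_dominated_convergence (F := fun (N : ℕ) (ω : BondConfig (Site d)) =>
      |((#(box d N) : ℝ))⁻¹ * (#((box d N).image fun x => openCluster ω x) : ℝ) - κ|)
    (f := fun _ => (0 : ℝ)) (fun _ => (2 : ℝ)) hmeas (integrable_const _)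
    (fun N => Eventually.of_forall fun ω => ?_) ?_
  · simpa only [integral_zero] using hlim
  · rw [Real.norm_eq_abs, abs_abs]
    have h := hratio N ω
    rw [abs_le]; constructor <;> linarith [h.1, h.2]
  · filter_upwards [ae_tendsto_card_image_openCluster_div_card_box hd b hp hq] with ω hω
    have h := (hω.sub_const κ).abs
    rwa [sub_self, abs_zero] at h

end Summit.CriticalPhenomena.PercolationContinuityZ3.Theorems.FK

end
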